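import Summits.ABC.ABC.Theorems.IneffectiveSubspaceUniformSadicTowerFourOnePrimeOfLevelOne
import Summits.ABC.ABC.Theorems.IneffectiveSubspaceUniformSadicTowerFourOnePrimeCyclotomicSquare

/-!
# `UniformSadicTowerFour` (stmt-ABC-14937), line `flat-steep-split` (lead c5): the ONE-LOG AXIS
# U₁ = UPD(1,1) of the one-prime / two-base bound — from the level-one rung at budget `K = 2`,
# from the crux, from `PrimePowerRadical` (fixed base), and its cyclotomic-square corollary

Lead c4's normal form of the first open rung `W = 3` of the crux's necessary condition
BoundedOmegaABC is the ONE-PRIME / TWO-BASE divisibility bound UPD(1,2) (sibling files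
`…OnePrimeOfLevelOne.lean`, `…OnePrimeCyclotomicSquare.lean`).  This file isolates its ONE-LOGARITHM
axis, the ONE-PRIME / ONE-BASE bound **U₁ = UPD(1,1)**: for every `ε > 0` there is `C` such that for
all distinct primes `p, r` and all `Z, t ∈ ℕ` with `p^t ∣ r^Z − 1` and `r^Z ≥ 2`

  `p^t ≤ C · (pr)^(1+ε) · (r^Z)^ε`

— the `p`-part of `r^Z − 1` is sub-polynomially small.  U₁ is inlined verbatim everywhere (no
definition); it is an abc-type statement and is OPEN.

* `oneBase_of_levelOneRung_two` — the level-one rung at budget `K = 2` already implies U₁, with the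
  SAME constant `C(ε)` (read the rung at `S = {p, r}` on the abc triple `(1, r^Z − 1, r^Z)`);
* `oneBase_of_uniformSadicTowerFour` — hence the crux implies U₁
  (`MixedRadical.levelOneRung_of_uniformSadicTowerFour` at `K = 2`), and `oneBase_of_abc` — so does
  `ABC` (through `abcGivesUniformSadic_proof`);
* `oneBase_fixedBase_of_primePowerRadical` — crux #3 `PrimePowerRadical` (abc for the triples
  `(1, r^k − 1, r^k)`, constant depending on the base `r`) implies U₁ for every FIXED base `r`, with a
  constant depending on `r`;
* `squareDivisor_pow_sub_one_of_oneBase` — U₁ ⟹ for every fixed `d ≥ 1` and `δ > 0` there is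
  `C = C(d, δ)` with `p ≤ C · r^(1+δ)` whenever `p ≠ r` are primes and `p² ∣ r^d − 1`;
* `squareDivisor_cyclotomicFive_of_oneBase` — U₁ ⟹ the same bound for square prime divisors
  `p² ∣ Φ₅(r) = r⁴ + r³ + r² + r + 1` (the cyclotomic-square certificate of
  `…OnePrimeCyclotomicSquare.lean` needs only the one-log axis, and no auxiliary prime).

**Proofs.** (1) Fix `ε`, take the rung's `C`.  Given `p ≠ r`, `p^t ∣ r^Z − 1`, `r^Z ≥ 2`, read the
rung at `S := {p, r}` (two primes) on the abc triple `(a, b, c) = (1, r^Z − 1, r^Z)`.  The `S`-free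
part `T := {abc}^S` divides `abc` (`onePrime_sfree_dvd`) and is coprime to `p` and `r`
(`onePrime_sfree_coprime`), hence to `c = r^Z` and to `p^t`; so `T ∣ b` and `T · p^t ∣ b`, whence
the integer inequality `B · p^t ≤ (pr) · b` for the bracket `B := (∏_{x ∈ S} x) · T = pr · T`
(`oneBase_bracket_mul_le`), and the real step `onePrime_real` of the sibling file turns
`c < C · B^(1+ε)` into `p^t ≤ C (pr)^(1+ε) c^ε`.  (2) Specialise the crux's level-one rung to `K = 2`.
(3) Fix a prime `r` and `ε`; take `C₀ = C₀(r, ε)` from `PrimePowerRadical`.  Given `p ≠ r`,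
`p^t ∣ r^Z − 1 =: b`, `r^Z ≥ 2` (so `Z ≥ 1`): `rad(1 · b · r^Z) = radical(b · r^Z)` divides
`radical(b) · r`, and `radical(b) · p^t ∣ p · b` (write `b = p^t m`; `radical(p^t m) ∣ p · radical m`
for `t ≥ 1`), so `rad · p^t ≤ (pr) · b` and `onePrime_real` applies verbatim to
`r^Z < C₀ · rad^(1+ε)`, giving `p^t ≤ C₀ (pr)^(1+ε) (r^Z)^ε`.  (4) Fix `d ≥ 1`, `δ > 0`, put
`ε := min(1/2, δ/(2(d+2)))` and take `C = C(ε)` of U₁; for `p² ∣ r^d − 1` (so `r^d ≥ 2`) U₁ gives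
`p² ≤ C (pr)^(1+ε) (r^d)^ε`, i.e. `p ≤ L · p^ε` with `L = C r^(1+ε+dε)`, whence
`p ≤ L^{1/(1−ε)} = C^{1/(1−ε)} r^{(1+ε+dε)/(1−ε)} ≤ C^{1/(1−ε)} r^(1+δ)` (`olAbsorb_rpow`,
`olFinal_le`).  (5) `r⁵ − 1 = (r − 1) Φ₅(r)` (`olPow_five_sub_one`) and (4) at `d = 5`.

Sources: the crux notes of the line `flat-steep-split` (`Cruxes/UniformSadicTowerFour/`, leads c4/c5:
the sandwich crux ⟹ UPD ⟹ rung `W = 3` and its one-log axis); the arguments are elementary unique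
factorisation and real-analysis bookkeeping [folklore].  Mathlib only (`Finset.prod_pair`,
`Finset.card_le_two`, `UniqueFactorizationMonoid.radical_mul_dvd`, `radical_dvd_self`,
`Nat.radical_eq_prod_primeFactors`, `Nat.primeFactors_prime_pow`, `Real.mul_rpow`, `Real.rpow_add`,
`Real.rpow_sub`, `Real.rpow_mul`, `Real.rpow_natCast`, `Real.rpow_le_rpow_of_exponent_le`) plus the
landed `onePrime_sfree_dvd`, `onePrime_sfree_coprime`, `onePrime_real`,
`MixedRadical.levelOneRung_of_uniformSadicTowerFour` and `abcGivesUniformSadic_proof`.  No new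
definitions.  Deliberately NOT here: U₁ itself and UPD(1,2) (OPEN, abc-type: hypotheses only),
`PrimePowerRadical` (crux #3, OPEN: hypothesis only), the splitting UPD ⟺ UPD⁺ ∧ U₁ and the other
stubs of the line (other files).
-/

noncomputable section

-- `Summit.<Summit>.<Problem>` is the mandated summit-side namespace (CONVENTIONS §2); for the
-- single-conjunct summit `ABC` the two coincide, so the duplicate `ABC.ABC` is deliberate.
set_option linter.dupNamespace false

namespace Summit.ABC.ABC.Theorems.UniformSadicTowerFour.BoundedOmega

open Literature.NumberTheory.DiophantineGeometry (IsABCTriple rad rad_def)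
open Summit.ABC.ABC.Theses.IneffectiveSubspace (UniformSadicTowerFour PrimePowerRadical)
open Summit.ABC.ABC.Theorems.UniformSadicTowerFour.MixedRadical (levelOneRung_of_uniformSadicTowerFour)
open UniqueFactorizationMonoid (radical radical_mul_dvd radical_dvd_self radical_pow_dvd)
open scoped BigOperators

/-! ## The integer inequality at two primes: bracket `· p^t ≤ pr · b` -/

/-- **The integer heart, two primes.** Let `(a, b, c)` be an abc triple, `p ≠ r` with `p` prime,
`p^t ∣ b`, and suppose the `S`-free part `T := {abc}^S` (`S = {p, r}`) is coprime to `a` and to `c`.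
Then `T ∣ abc` forces `T ∣ b`, `T` is prime to `p^t`, so `T · p^t ∣ b` and the bracket
`B = (∏_{x ∈ S} x) · T = pr · T` satisfies `B · p^t ≤ pr · b` (the two-prime analogue of
`onePrime_bracket_mul_le`). [folklore] -/
theorem oneBase_bracket_mul_le {a b c p r t : ℕ} (habc : IsABCTriple a b c) (hp : p.Prime)
    (hpr : p ≠ r) (ht : p ^ t ∣ b)
    (hTa : Nat.Coprime
      (∏ ℓ ∈ (a * b * c).primeFactors \ {p, r}, ℓ ^ (a * b * c).factorization ℓ) a)
    (hTc : Nat.Coprime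
      (∏ ℓ ∈ (a * b * c).primeFactors \ {p, r}, ℓ ^ (a * b * c).factorization ℓ) c) :
    ((∏ x ∈ ({p, r} : Finset ℕ), x) *
        ∏ ℓ ∈ (a * b * c).primeFactors \ {p, r}, ℓ ^ (a * b * c).factorization ℓ) * p ^ t ≤
      p * r * b := by
  obtain ⟨-, hb, -, -⟩ := habc
  have hTabc := onePrime_sfree_dvd (a * b * c) {p, r}
  have hTb := hTa.dvd_of_dvd_mul_left (hTc.dvd_of_dvd_mul_right hTabc)
  have hTp := (onePrime_sfree_coprime (M := a * b * c) hp
    (by simp : p ∈ ({p, r} : Finset ℕ))).pow_right t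
  have hle := Nat.le_of_dvd hb (hTp.mul_dvd_of_dvd_of_dvd hTb ht)
  rw [Finset.prod_pair hpr, mul_assoc]
  exact Nat.mul_le_mul_left _ hle

/-! ## U₁ from the level-one rung at budget `K = 2`, from the crux, from `ABC` -/

/-- **Level-one rung at budget `2` ⟹ U₁ = UPD(1,1)** (same constant `C(ε)`).  For distinct primes
`p, r` and `Z, t ∈ ℕ` with `p^t ∣ r^Z − 1` and `r^Z ≥ 2`: `p^t ≤ C · (pr)^(1+ε) · (r^Z)^ε` — read the
rung at `S = {p, r}` on the abc triple `(1, r^Z − 1, r^Z)`; the `S`-free part of `abc` times `p^t`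
divides `b = r^Z − 1 < c` (`oneBase_bracket_mul_le`), and `onePrime_real`. [folklore] -/
theorem oneBase_of_levelOneRung_two
    (h : ∀ ε : ℝ, 0 < ε → ∃ C : ℝ, 0 < C ∧ ∀ S : Finset ℕ, S.card ≤ 2 → (∀ p ∈ S, Nat.Prime p) →
      ∀ a b c : ℕ, IsABCTriple a b c →
        (c : ℝ) < C * ((((∏ p ∈ S, p) *
          ∏ p ∈ (a * b * c).primeFactors \ S, p ^ (a * b * c).factorization p : ℕ) : ℝ)) ^ (1 + ε)) :
    ∀ ε : ℝ, 0 < ε → ∃ C : ℝ, 0 < C ∧ ∀ p r : ℕ, p.Prime → r.Prime → p ≠ r → ∀ Z t : ℕ,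
      p ^ t ∣ r ^ Z - 1 → 2 ≤ r ^ Z →
      ((p ^ t : ℕ) : ℝ) ≤ C * ((p * r : ℕ) : ℝ) ^ (1 + ε) * ((r ^ Z : ℕ) : ℝ) ^ ε := by
  intro ε hε
  obtain ⟨C, hC, hS⟩ := h ε hε
  refine ⟨C, hC, ?_⟩
  intro p r hp hr hpr Z t hdvd h2
  have hcard : ({p, r} : Finset ℕ).card ≤ 2 := Finset.card_le_two
  have hprime : ∀ x ∈ ({p, r} : Finset ℕ), x.Prime := by
    intro x hx
    simp only [Finset.mem_insert, Finset.mem_singleton] at hx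
    rcases hx with rfl | rfl <;> assumption
  have hP : 1 ≤ p ^ t := Nat.one_le_pow _ _ hp.pos
  have hrS : r ∈ ({p, r} : Finset ℕ) := by simp
  -- the abc triple `(1, r^Z - 1, r^Z)`
  have habc : IsABCTriple 1 (r ^ Z - 1) (r ^ Z) :=
    ⟨one_pos, by omega, by omega, Nat.coprime_one_left _⟩
  have hrung := hS {p, r} hcard hprime 1 (r ^ Z - 1) (r ^ Z) habc
  have hnat := oneBase_bracket_mul_le habc hp hpr hdvd (Nat.coprime_one_right _)
    ((onePrime_sfree_coprime hr hrS).pow_right Z)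
  exact onePrime_real hC hε (by omega) hrung hnat (by omega) hP

/-- **Crux ⟹ U₁.** `UniformSadicTowerFour` ("Ridout at level four") implies the one-prime /
one-base divisibility bound: for every `ε > 0` some `C` bounds the `p`-part of `r^Z − 1` (when
`r^Z ≥ 2`) by `C · (pr)^(1+ε) · (r^Z)^ε`, for all distinct primes `p, r` — through the crux's
level-one rung at budget `K = 2` (`MixedRadical.levelOneRung_of_uniformSadicTowerFour`) and
`oneBase_of_levelOneRung_two`. [folklore] -/
theorem oneBase_of_uniformSadicTowerFour (hU : UniformSadicTowerFour) :
    ∀ ε : ℝ, 0 < ε → ∃ C : ℝ, 0 < C ∧ ∀ p r : ℕ, p.Prime → r.Prime → p ≠ r → ∀ Z t : ℕ,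
      p ^ t ∣ r ^ Z - 1 → 2 ≤ r ^ Z →
      ((p ^ t : ℕ) : ℝ) ≤ C * ((p * r : ℕ) : ℝ) ^ (1 + ε) * ((r ^ Z : ℕ) : ℝ) ^ ε :=
  oneBase_of_levelOneRung_two (levelOneRung_of_uniformSadicTowerFour hU 2)

/-- **ABC ⟹ U₁.** The abc conjecture implies the one-prime / one-base divisibility bound, through
`ABC ⟹ UniformSadicTowerFour` (`abcGivesUniformSadic_proof`) and
`oneBase_of_uniformSadicTowerFour`. [folklore] -/
theorem oneBase_of_abc (h : ABC) :
    ∀ ε : ℝ, 0 < ε → ∃ C : ℝ, 0 < C ∧ ∀ p r : ℕ, p.Prime → r.Prime → p ≠ r → ∀ Z t : ℕ,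
      p ^ t ∣ r ^ Z - 1 → 2 ≤ r ^ Z →
      ((p ^ t : ℕ) : ℝ) ≤ C * ((p * r : ℕ) : ℝ) ^ (1 + ε) * ((r ^ Z : ℕ) : ℝ) ^ ε :=
  oneBase_of_uniformSadicTowerFour (abcGivesUniformSadic_proof h)

/-! ## U₁ for a fixed base from `PrimePowerRadical` -/

/-- **Radical of a multiple of a prime power.** If `p` is prime and `p^t ∣ m`, then
`radical(m) · p^t ∣ p · m`: trivial for `t = 0` (`radical m ∣ m`); for `t ≥ 1` write `m = p^t k`,
so `radical(p^t k) ∣ radical(p^t) · radical(k) = p · radical(k) ∣ p · k`. [folklore] -/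
theorem oneBase_radical_mul_pow_dvd {p m t : ℕ} (hp : p.Prime) (ht : p ^ t ∣ m) :
    radical m * p ^ t ∣ p * m := by
  rcases Nat.eq_zero_or_pos t with rfl | ht0
  · rw [pow_zero, mul_one]
    exact Dvd.dvd.mul_left radical_dvd_self p
  · obtain ⟨k, rfl⟩ := ht
    have hrad : radical (p ^ t) = p := by
      rw [Nat.radical_eq_prod_primeFactors, Nat.primeFactors_prime_pow ht0.ne' hp,
        Finset.prod_singleton]
    have h1 : radical (p ^ t * k) ∣ p * radical k := by
      have h0 : radical (p ^ t * k) ∣ radical (p ^ t) * radical k := radical_mul_dvd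
      rwa [hrad] at h0
    calc radical (p ^ t * k) * p ^ t ∣ p * radical k * p ^ t := mul_dvd_mul_right h1 _
      _ ∣ p * k * p ^ t := mul_dvd_mul_right (mul_dvd_mul_left p radical_dvd_self) _
      _ = p * (p ^ t * k) := by ring

/-- **The integer inequality for the triple `(1, r^Z − 1, r^Z)`.** For a prime `p` with
`p^t ∣ r^Z − 1`: `rad(1 · (r^Z − 1) · r^Z) · p^t ≤ (pr) · (r^Z − 1)` as soon as `r^Z ≥ 2` — since
`radical((r^Z − 1) r^Z) ∣ radical(r^Z − 1) · radical(r^Z) ∣ radical(r^Z − 1) · r` and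
`radical(r^Z − 1) · p^t ∣ p (r^Z − 1)` (`oneBase_radical_mul_pow_dvd`). [folklore] -/
theorem oneBase_rad_mul_pow_le {p r Z t : ℕ} (hp : p.Prime) (ht : p ^ t ∣ r ^ Z - 1)
    (h2 : 2 ≤ r ^ Z) : rad 1 (r ^ Z - 1) (r ^ Z) * p ^ t ≤ p * r * (r ^ Z - 1) := by
  have hb : 0 < r ^ Z - 1 := by omega
  have hr0 : 0 < r := Nat.pos_of_ne_zero fun h0 => by
    subst h0
    rcases Z with _ | Z <;> simp at h2
  have hdvd : rad 1 (r ^ Z - 1) (r ^ Z) * p ^ t ∣ p * r * (r ^ Z - 1) := by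
    rw [rad_def, one_mul]
    have hrZ : radical (r ^ Z) ∣ r := (radical_pow_dvd (a := r) (n := Z)).trans radical_dvd_self
    calc radical ((r ^ Z - 1) * r ^ Z) * p ^ t
        ∣ radical (r ^ Z - 1) * radical (r ^ Z) * p ^ t := mul_dvd_mul_right radical_mul_dvd _
      _ ∣ radical (r ^ Z - 1) * r * p ^ t := mul_dvd_mul_right (mul_dvd_mul_left _ hrZ) _
      _ = r * (radical (r ^ Z - 1) * p ^ t) := by ring
      _ ∣ r * (p * (r ^ Z - 1)) := mul_dvd_mul_left r (oneBase_radical_mul_pow_dvd hp ht)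
      _ = p * r * (r ^ Z - 1) := by ring
  exact Nat.le_of_dvd (Nat.mul_pos (Nat.mul_pos hp.pos hr0) hb) hdvd

/-- **`PrimePowerRadical` ⟹ U₁ for every fixed base.** Crux #3 (abc for the triples
`(1, r^k − 1, r^k)`, `r^k < C₀(r, ε) · rad(1 · (r^k − 1) · r^k)^(1+ε)`) implies, for every FIXED
prime base `r` and every `ε > 0`, a constant `C = C₀(r, ε)` with `p^t ≤ C · (pr)^(1+ε) · (r^Z)^ε`
whenever `p ≠ r` is prime, `p^t ∣ r^Z − 1` and `r^Z ≥ 2`: the integer inequality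
`rad · p^t ≤ (pr) · (r^Z − 1)` (`oneBase_rad_mul_pow_le`) and the real step `onePrime_real` applied
to `r^Z < C₀ · rad^(1+ε)`. [folklore] -/
theorem oneBase_fixedBase_of_primePowerRadical (h : PrimePowerRadical) :
    ∀ r : ℕ, r.Prime → ∀ ε : ℝ, 0 < ε → ∃ C : ℝ, 0 < C ∧ ∀ p : ℕ, p.Prime → p ≠ r → ∀ Z t : ℕ,
      p ^ t ∣ r ^ Z - 1 → 2 ≤ r ^ Z →
      ((p ^ t : ℕ) : ℝ) ≤ C * ((p * r : ℕ) : ℝ) ^ (1 + ε) * ((r ^ Z : ℕ) : ℝ) ^ ε := by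
  intro r hr ε hε
  obtain ⟨C, hC, H⟩ := h r hr ε hε
  refine ⟨C, hC, ?_⟩
  intro p hp _hpr Z t hdvd h2
  have hZ : 1 ≤ Z := by
    rcases Nat.eq_zero_or_pos Z with rfl | hZ
    · rw [pow_zero] at h2; omega
    · exact hZ
  exact onePrime_real hC hε (by omega) (H Z hZ) (oneBase_rad_mul_pow_le hp hdvd h2) (by omega)
    (Nat.one_le_pow _ _ hp.pos)

/-! ## Real-analysis bookkeeping: absorbing `p^ε` and the exponent `(1+ε+dε)/(1−ε) ≤ 1+δ` -/

/-- Absorption of a small power: if `c ≥ 1`, `θ < 1` and `c ≤ L · c^θ` in `ℝ`, then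
`c ≤ L^{1/(1−θ)}` — divide by `c^θ > 0` to get `c^{1−θ} ≤ L` and raise both sides to the power
`1/(1−θ) > 0` (re-proved from the sibling file `…OnePrimeCyclotomicSquare.lean`). [folklore] -/
private theorem olAbsorb_rpow {c L θ : ℝ} (hc : 1 ≤ c) (hθ : θ < 1) (h : c ≤ L * c ^ θ) :
    c ≤ L ^ (1 / (1 - θ)) := by
  have hc0 : 0 < c := one_pos.trans_le hc
  have h1θ : 0 < 1 - θ := sub_pos.2 hθ
  have h1 : c ^ (1 - θ) ≤ L := by
    rw [Real.rpow_sub hc0, Real.rpow_one, div_le_iff₀ (Real.rpow_pos_of_pos hc0 θ)]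
    exact h
  calc c = (c ^ (1 - θ)) ^ (1 / (1 - θ)) := by
        rw [← Real.rpow_mul hc0.le, mul_one_div_cancel h1θ.ne', Real.rpow_one]
    _ ≤ L ^ (1 / (1 - θ)) :=
        Real.rpow_le_rpow (Real.rpow_nonneg hc0.le _) h1 (one_div_pos.2 h1θ).le

/-- The real final step (one base, no auxiliary prime).  Let `0 < ε ≤ 1/2`, `δ > 0` with
`ε · 2(d+2) ≤ δ`, `C > 0`, `P, R ≥ 1` in `ℝ` with `P² ≤ C · (PR)^(1+ε) · (R^d)^ε`.  Since
`(PR)^(1+ε) = P · P^ε · R^(1+ε)` this reads `P ≤ L · P^ε` with `L = C R^(1+ε) (R^d)^ε = C R^(1+ε+dε)`,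
so (`olAbsorb_rpow`) `P ≤ L^{1/(1−ε)} = C^{1/(1−ε)} R^{(1+ε+dε)/(1−ε)}`, and
`(1+ε+dε)/(1−ε) ≤ 1 + δ` because `2ε + dε + δε ≤ δ/2 + δ/2`, with `R ≥ 1`. [folklore] -/
private theorem olFinal_le {ε δ C P R : ℝ} {d : ℕ} (hε : 0 < ε) (hε1 : ε ≤ 1 / 2) (hδ : 0 < δ)
    (hεd : ε * (2 * (d + 2)) ≤ δ) (hC : 0 < C) (hP : 1 ≤ P) (hR : 1 ≤ R)
    (h : P ^ 2 ≤ C * (P * R) ^ (1 + ε) * (R ^ d) ^ ε) :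
    P ≤ C ^ (1 / (1 - ε)) * R ^ (1 + δ) := by
  have hP0 : 0 < P := one_pos.trans_le hP
  have hR0 : 0 < R := one_pos.trans_le hR
  have hε' : ε < 1 := by linarith
  -- `(PR)^(1+ε) = P · P^ε · R^(1+ε)`
  have hsplit : (P * R) ^ (1 + ε) = P * P ^ ε * R ^ (1 + ε) := by
    rw [Real.mul_rpow hP0.le hR0.le, Real.rpow_add hP0, Real.rpow_one]
  -- `P ≤ L · P^ε` with `L = C R^(1+ε) (R^d)^ε`, and absorption
  have h1 : P ≤ C * R ^ (1 + ε) * (R ^ d) ^ ε * P ^ ε := by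
    refine le_of_mul_le_mul_left ?_ hP0
    calc P * P = P ^ 2 := (sq P).symm
      _ ≤ C * (P * R) ^ (1 + ε) * (R ^ d) ^ ε := h
      _ = P * (C * R ^ (1 + ε) * (R ^ d) ^ ε * P ^ ε) := by rw [hsplit]; ring
  have h2 : P ≤ (C * R ^ (1 + ε) * (R ^ d) ^ ε) ^ (1 / (1 - ε)) := olAbsorb_rpow hP hε' h1
  -- `L = C · R^(1+ε+dε)`
  have hRd : (R ^ d) ^ ε = R ^ ((d : ℝ) * ε) := by
    rw [← Real.rpow_natCast R d, ← Real.rpow_mul hR0.le]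
  have hLeq : C * R ^ (1 + ε) * (R ^ d) ^ ε = C * R ^ (1 + ε + d * ε) := by
    rw [hRd, Real.rpow_add hR0 (1 + ε) (d * ε)]; ring
  -- the exponent `(1+ε+dε)/(1−ε) ≤ 1+δ`
  have hεδ : ε * δ ≤ 1 / 2 * δ := mul_le_mul_of_nonneg_right hε1 hδ.le
  have hexp : (1 + ε + d * ε) * (1 / (1 - ε)) ≤ 1 + δ := by
    rw [mul_one_div, div_le_iff₀ (by linarith : (0 : ℝ) < 1 - ε)]
    nlinarith
  have h3 : (C * R ^ (1 + ε + d * ε)) ^ (1 / (1 - ε)) ≤ C ^ (1 / (1 - ε)) * R ^ (1 + δ) := by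
    rw [Real.mul_rpow hC.le (by positivity), ← Real.rpow_mul hR0.le]
    exact mul_le_mul_of_nonneg_left (Real.rpow_le_rpow_of_exponent_le hR hexp) (by positivity)
  calc P ≤ (C * R ^ (1 + ε) * (R ^ d) ^ ε) ^ (1 / (1 - ε)) := h2
    _ = (C * R ^ (1 + ε + d * ε)) ^ (1 / (1 - ε)) := by rw [hLeq]
    _ ≤ C ^ (1 / (1 - ε)) * R ^ (1 + δ) := h3

/-- The cyclotomic factorisation `r⁵ − 1 = (r − 1) · (r⁴ + r³ + r² + r + 1)` in `ℕ` (truncated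
subtraction; at `r = 0` both sides vanish; re-proved from the sibling file). [folklore] -/
private theorem olPow_five_sub_one (r : ℕ) :
    r ^ 5 - 1 = (r - 1) * (r ^ 4 + r ^ 3 + r ^ 2 + r + 1) := by
  rcases r with _ | r
  · simp
  · have h : (r + 1) ^ 5 =
        r * ((r + 1) ^ 4 + (r + 1) ^ 3 + (r + 1) ^ 2 + (r + 1) + 1) + 1 := by ring
    rw [h, Nat.add_sub_cancel, Nat.add_sub_cancel]

/-! ## Square divisors of `r^d − 1` and of `Φ₅(r)` from U₁ -/

/-- **U₁ ⟹ square prime divisors of `r^d − 1` are small.** For every fixed `d ≥ 1` and `δ > 0`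
there is `C` with `p ≤ C · r^(1+δ)` whenever `p ≠ r` are primes and `p² ∣ r^d − 1`.  Proof: with
`ε = min(1/2, δ/(2(d+2)))` and the constant `C(ε)` of U₁ (at `Z = d`, `t = 2`; `r^d ≥ 2`):
`p² ≤ C (pr)^(1+ε) (r^d)^ε`, absorbed by `olFinal_le` into `p ≤ C^{1/(1−ε)} · r^(1+δ)` — the
one-log version of `squareDivisor_pow_sub_one_of_onePrimeTwoBase`, with no auxiliary prime.
[folklore] -/
theorem squareDivisor_pow_sub_one_of_oneBase
    (h : ∀ ε : ℝ, 0 < ε → ∃ C : ℝ, 0 < C ∧ ∀ p r : ℕ, p.Prime → r.Prime → p ≠ r → ∀ Z t : ℕ,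
      p ^ t ∣ r ^ Z - 1 → 2 ≤ r ^ Z →
      ((p ^ t : ℕ) : ℝ) ≤ C * ((p * r : ℕ) : ℝ) ^ (1 + ε) * ((r ^ Z : ℕ) : ℝ) ^ ε)
    {d : ℕ} (hd : 1 ≤ d) : ∀ δ : ℝ, 0 < δ → ∃ C : ℝ, 0 < C ∧ ∀ p r : ℕ, p.Prime → r.Prime → p ≠ r →
      p ^ 2 ∣ r ^ d - 1 → (p : ℝ) ≤ C * (r : ℝ) ^ (1 + δ) := by
  intro δ hδ
  -- the auxiliary exponent `ε = min(1/2, δ/(2(d+2)))`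
  obtain ⟨ε, hε0, hε1, hεd⟩ : ∃ ε : ℝ, 0 < ε ∧ ε ≤ 1 / 2 ∧ ε * (2 * (d + 2)) ≤ δ :=
    ⟨min (1 / 2) (δ / (2 * (d + 2))), lt_min (by norm_num) (by positivity), min_le_left _ _,
      (le_div_iff₀ (by positivity)).1 (min_le_right _ _)⟩
  obtain ⟨C, hC, H⟩ := h ε hε0
  refine ⟨C ^ (1 / (1 - ε)), Real.rpow_pos_of_pos hC _, ?_⟩
  intro p r hp hr hpr hdvd
  have h2 : 2 ≤ r ^ d := Nat.one_lt_pow (by omega) hr.one_lt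
  have key := H p r hp hr hpr d 2 hdvd h2
  simp only [Nat.cast_pow, Nat.cast_mul] at key
  have hP : (1 : ℝ) ≤ p := by exact_mod_cast hp.one_lt.le
  have hR : (1 : ℝ) ≤ r := by exact_mod_cast hr.one_lt.le
  exact olFinal_le hε0 hε1 hδ hεd hC hP hR key

/-- **U₁ ⟹ square prime divisors of `Φ₅(r)` are small.** Large square divisors of the cyclotomic
value `Φ₅(r) = r⁴ + r³ + r² + r + 1` at a prime `r` are small:
`p² ∣ Φ₅(r) ⟹ p ≤ C_δ · r^(1+δ)` for primes `p ≠ r` — already from the ONE-LOG axis U₁ of UPD(1,2)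
(compare `squareDivisor_cyclotomicFive_of_onePrimeTwoBase`).  Proof: `Φ₅(r) ∣ r⁵ − 1`
(`olPow_five_sub_one`) and `squareDivisor_pow_sub_one_of_oneBase` with `d = 5`. [folklore] -/
theorem squareDivisor_cyclotomicFive_of_oneBase
    (h : ∀ ε : ℝ, 0 < ε → ∃ C : ℝ, 0 < C ∧ ∀ p r : ℕ, p.Prime → r.Prime → p ≠ r → ∀ Z t : ℕ,
      p ^ t ∣ r ^ Z - 1 → 2 ≤ r ^ Z →
      ((p ^ t : ℕ) : ℝ) ≤ C * ((p * r : ℕ) : ℝ) ^ (1 + ε) * ((r ^ Z : ℕ) : ℝ) ^ ε) :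
    ∀ δ : ℝ, 0 < δ → ∃ C : ℝ, 0 < C ∧ ∀ p r : ℕ, p.Prime → r.Prime → p ≠ r →
      p ^ 2 ∣ r ^ 4 + r ^ 3 + r ^ 2 + r + 1 → (p : ℝ) ≤ C * (r : ℝ) ^ (1 + δ) := by
  intro δ hδ
  obtain ⟨C, hC, H⟩ := squareDivisor_pow_sub_one_of_oneBase h (d := 5) (by norm_num) δ hδ
  refine ⟨C, hC, fun p r hp hr hpr hdvd => H p r hp hr hpr ?_⟩
  rw [olPow_five_sub_one]
  exact Dvd.dvd.mul_left hdvd _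

end Summit.ABC.ABC.Theorems.UniformSadicTowerFour.BoundedOmega

end
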